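import Mathlib

/-!
# Sketch — BN-SYM-F «concavification gain ≤ lift excess» (hub-lb-sym-idea-1 g1; crux `LowerEdge_ge_m4o5`,
stmt-Ventures-21721, rider stmt-Ventures-22024)

Setting (abstract, exact).  Hamiltonians live in a real vector space `E`; a (pseudo-)state is a linear
functional `x : Module.Dual ℝ E` (the pseudo-moment vector read as `h ↦ ⟨h, x⟩`).  For a FIXED
(Hamiltonian-independent) feasible set `S ⊆ Module.Dual ℝ E` the OFF-VALUE is
`offValue S h = inf_{x ∈ S} x h`.

* With `S = 𝒮_true` (expectation functionals of genuine states) `offValue` is the exact ground-state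
  energy functional `e₀`; with `S = S_off` (Gram-PSD ∩ translation/normalisation/density rows — every row
  whose validity does NOT use that the state is stationary/ground for `h`) it is the value of the
  «h-independent part» of a moment relaxation.  Rows that DO use `h` (eom `ω([h,X]) = 0`, Krylov/FQM/GC-pivot
  `ω(X†[h,X]) ≥ 0`, …) shrink the feasible set to `S(h) ⊆ S_off`; write the certified value as
  `R(h) = offValue S_off h + L(h)` with the LIFT `L(h) ≥ 0` bought by the h-dependent rows.

* `sum_offBound_le_offValue` : for nonnegative weights `w i` and members `h i`, any valid lower bounds
  `Roff i ≤ x (h i) ∀ x ∈ S` satisfy `∑ w i * Roff i ≤ offValue S (∑ w i • h i)`.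
  Read with `S = 𝒮_true`: the TRANSFER `e₀(∑ wᵢ hᵢ) ≥ ∑ wᵢ Rᵢ` (concavity + positive homogeneity of `e₀`;
  ODD-DEF, U-chords, t′-chords, pencils are all instances).  Read with `S = S_off`: Jensen for the off-value.

* `concavification_gain_le_lift_excess` : the gain of ANY such concave combination of member certificates
  `R i = Roff i + L i` over the target's own certificate `offValue S_off h̄ + Lh̄` is at most the
  LIFT EXCESS `∑ w i * L i − Lh̄`.  Hence a deformation/twin/chord family can beat the direct certificate at
  `h̄` by no more than (weighted mean of the members' h-dependent-row lifts) − (lift at `h̄`).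

Relation to the record: BN-idea9-g4-1 (LENS-CENSUS-idea9-g4 §2) is the case `L ≡ 0` (θ-independent cone ⇒ zero
gain); this file adds the h-dependent rows as the lift `L` and bounds the gain by the lift excess.

Numbers of record this bound explains (FLOAT, CORE #294 w3, sym-eng-1 kit j301152 odddef_table): lift
`L(0) = 5.194e-3`; nematic channel `L(0.4) = 3.584e-3` ⇒ bound `≤ −1.6e-3` (measured chord gain −1.37e-1);
spin channel `L(0.4) = 5.477e-3` ⇒ bound `≤ +2.83e-4` (measured EOM-transfer term +2.83e-4, chord gain
−7.77e-3).  For `LowerEdge_ge_m4o5` from E₁ (−0.8296) the class needs a lift excess ≥ +2.96e-2 ≈ 5.7× the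
ENTIRE eom lift at CORE.  HONEST FRAMING: two elementary inequalities; no bound of record moves; 0 μt;
no summit or crux statement is proved here; nothing here predicts superconductivity.
-/

namespace Summit.Ventures.CertifiedManyBodySolver.Cruxes.LowerEdge_ge_m4o5.Concavification

open Finset BigOperators

variable {E : Type*} [AddCommGroup E] [Module ℝ E]

/-- Off-value of `h` over a FIXED feasible set `S` of linear functionals (pseudo-states):
`inf_{x ∈ S} x h` (as `sInf` of the image; meaningful when the image is nonempty and bounded below,
which the hypotheses of the lemmas below provide). -/
noncomputable def offValue (S : Set (Module.Dual ℝ E)) (h : E) : ℝ :=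
  sInf ((fun x : Module.Dual ℝ E => x h) '' S)

/-- The off-value is a valid lower bound on `S`. -/
theorem offValue_le (S : Set (Module.Dual ℝ E)) (h : E) (c : ℝ)
    (hc : ∀ x ∈ S, c ≤ x h) {x : Module.Dual ℝ E} (hx : x ∈ S) :
    offValue S h ≤ x h := by
  unfold offValue
  exact csInf_le ⟨c, by rintro _ ⟨y, hy, rfl⟩; exact hc y hy⟩ ⟨x, hx, rfl⟩

/-- JENSEN / TRANSFER.  Nonnegatively weighted valid lower bounds of the members average to at most the
off-value at the weighted sum of the member Hamiltonians.  (`S = 𝒮_true`: certificate transfer by concavity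
and positive homogeneity of `e₀`; `S = S_off`: concavity of the h-independent relaxation value.) -/
theorem sum_offBound_le_offValue {ι : Type*} (t : Finset ι) (w : ι → ℝ) (h : ι → E)
    (S : Set (Module.Dual ℝ E)) (hS : S.Nonempty) (Roff : ι → ℝ)
    (hw : ∀ i ∈ t, 0 ≤ w i) (hvalid : ∀ i ∈ t, ∀ x ∈ S, Roff i ≤ x (h i)) :
    ∑ i ∈ t, w i * Roff i ≤ offValue S (∑ i ∈ t, w i • h i) := by
  unfold offValue
  apply le_csInf (hS.image _)
  rintro _ ⟨x, hx, rfl⟩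
  simp only [map_sum, map_smul, smul_eq_mul]
  exact Finset.sum_le_sum fun i hi => mul_le_mul_of_nonneg_left (hvalid i hi x hx) (hw i hi)

/-- BN-SYM-F.  CONCAVIFICATION GAIN ≤ LIFT EXCESS.  Member certificates `Roff i + L i` (off-part valid on
the common h-independent set `S`, plus the lift of their h-dependent rows), target certificate
`offValue S h̄ + Lbar` at `h̄ = ∑ w i • h i`: the concave-combination gain over the target is at most
`∑ w i * L i − Lbar`. -/
theorem concavification_gain_le_lift_excess {ι : Type*} (t : Finset ι) (w : ι → ℝ) (h : ι → E)
    (S : Set (Module.Dual ℝ E)) (hS : S.Nonempty) (Roff L : ι → ℝ) (Lbar : ℝ)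
    (hw : ∀ i ∈ t, 0 ≤ w i) (hvalid : ∀ i ∈ t, ∀ x ∈ S, Roff i ≤ x (h i)) :
    (∑ i ∈ t, w i * (Roff i + L i)) - (offValue S (∑ i ∈ t, w i • h i) + Lbar)
      ≤ (∑ i ∈ t, w i * L i) - Lbar := by
  have hJ := sum_offBound_le_offValue t w h S hS Roff hw hvalid
  have hsplit : ∑ i ∈ t, w i * (Roff i + L i) = ∑ i ∈ t, w i * Roff i + ∑ i ∈ t, w i * L i := by
    rw [← Finset.sum_add_distrib]; exact Finset.sum_congr rfl fun i _ => by ring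
  rw [hsplit]
  linarith

/-- Corollary (the screen).  If every member's lift is at most the target's (`L i ≤ Lbar`) and the weights
sum to one, the concave combination CANNOT beat the target certificate. -/
theorem no_gain_of_lift_le {ι : Type*} (t : Finset ι) (w : ι → ℝ) (h : ι → E)
    (S : Set (Module.Dual ℝ E)) (hS : S.Nonempty) (Roff L : ι → ℝ) (Lbar : ℝ)
    (hw : ∀ i ∈ t, 0 ≤ w i) (hw1 : ∑ i ∈ t, w i = 1)
    (hvalid : ∀ i ∈ t, ∀ x ∈ S, Roff i ≤ x (h i)) (hL : ∀ i ∈ t, L i ≤ Lbar) :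
    ∑ i ∈ t, w i * (Roff i + L i) ≤ offValue S (∑ i ∈ t, w i • h i) + Lbar := by
  have hg := concavification_gain_le_lift_excess t w h S hS Roff L Lbar hw hvalid
  have hLs : ∑ i ∈ t, w i * L i ≤ Lbar := by
    calc ∑ i ∈ t, w i * L i ≤ ∑ i ∈ t, w i * Lbar :=
          Finset.sum_le_sum fun i hi => mul_le_mul_of_nonneg_left (hL i hi) (hw i hi)
      _ = Lbar := by rw [← Finset.sum_mul, hw1, one_mul]
  linarith

/-- Two-member symmetric chord (the ODD-DEF / U-twin shape): `h̄ = ½ h₊ + ½ h₋`. -/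
theorem chord_gain_le_lift_excess (hp hm : E) (S : Set (Module.Dual ℝ E)) (hS : S.Nonempty)
    (Rp Rm Lp Lm Lbar : ℝ)
    (hvp : ∀ x ∈ S, Rp ≤ x hp) (hvm : ∀ x ∈ S, Rm ≤ x hm) :
    ((Rp + Lp) + (Rm + Lm)) / 2 - (offValue S ((1/2 : ℝ) • hp + (1/2 : ℝ) • hm) + Lbar)
      ≤ (Lp + Lm) / 2 - Lbar := by
  have hJ := sum_offBound_le_offValue (Finset.univ : Finset (Fin 2)) (fun _ => (1/2 : ℝ)) ![hp, hm] S hS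
    ![Rp, Rm] (fun _ _ => by norm_num)
    (fun i _ x hx => by fin_cases i <;> simp [hvp x hx, hvm x hx])
  simp [Fin.sum_univ_two] at hJ
  linarith

end Summit.Ventures.CertifiedManyBodySolver.Cruxes.LowerEdge_ge_m4o5.Concavification
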